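import Summits.QuantumFields.YangMills.Theorems.BalabanLadderUVSeamRecCeilingsDLRPeelingSmallCollar
import Literature.Probability.LatticeModels.PSCornerEncoding
import HarnessLib

/-!
# Crux `UVSeamRec` (stmt-QuantumFields-20043), lane B: the (UCR) ⇒ doubled-moments engine of DLR peeling for EVERY collar `m ≥ 3` and
# every odd block size — the top levels whose collar cube outgrows the torus are free

Helper file (`--supports stmt-QuantumFields-20043`) of the width-lever seat `ym-20043-ceilings-p2` (lane B, gen 7); sequel of
`…CeilingsDLRPeelingSmallCollar` (the small-collar window cell law from (UCR_k), `m ≥ 3`, any `b`).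

THE POINT.  g6's engine `torusE_exp_two_mul_sum_influence_le_of_uniformConditionalRarity` (and its small-collar twin) cap the collar at
`m ≤ 7`: only then does the collar cube of side `(2m+1)b^k` of EVERY family-shell level (`2b^k ≤ R`) fit in the (RM) torus
(`2L+1 ≥ 8R+17`).  But the cap ties the one-box hypothesis (UCR) to thresholds above the flat-penetration value `≈ π⁴/(2(2m+1)⁴)` of a
SMALL collar cube (`9.6·10⁻⁴` at `m = 7`, LEAD 20043 FINDING #50), whereas the intended supplier (Bałaban's small-field parameter `ε`) may want
`ε` far smaller — i.e. a LARGE collar.  The cap is unnecessary: at a level whose collar cube does not fit, the window cell law with activity `1`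
holds trivially, and such levels are few — they satisfy `8R < (2m+1)b^k` together with `2b^k ≤ R`, an interval of at most `m` consecutive levels
(`card_badLevels_le`: `16·b^{k−k₀} < 2m+1 ≤ 3^m`).  Hence:
* `torusE_exp_two_mul_sum_influence_le_of_uniformConditionalRarity_anyCollar` — fundamental Wilson state of `SU(N)` on the odd torus `2L+1`,
  reduced `2R+4`-separated cube family, `4R+8 ≤ L`; ANY odd block size, ANY collar `m ≥ 3`; weights `w k ∈ [0,1]` with (UCR_k) at every level
  `k ≥ 1` ⇒ `⟨exp(2 Σ_{i∈T} influence∘lift)⟩ ≤ exp(2e²·1536·(δ₀ + (Σ_{1≤k≤kmax} w_k^{1/(16K)} + m))·#T)`, `K = 256(2m+4)⁴` — g6's constant plus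
  the additive `m` for the free top levels.
The (RM) press-buttons and the v8 glue for every collar are the sequel `…CeilingsDLRPeelingAnyCollarGlue`.

HONEST FRAMING.  Reductions (folklore probability); (UCR_k) is the OPEN one-box large-field input (Bałaban's R-operation currency with Dirichlet
data); with the collar free, its thresholds may sit as low as the flat-penetration value of a cube of side `(2m+1)b^k` for any fixed `m` — the
classical consistency condition becomes `ε(β,k) ≳ π⁴/(2(2m+1)⁴)` with `m` at the supplier's disposal; nothing of E0′; not a gap, not Clay.
References: folklore; T. Bałaban, Commun. Math. Phys. 122 (1989) 355–392 (intended supplier).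
-/

set_option autoImplicit false

noncomputable section

open MeasureTheory Filter Topology Finset
open Literature.Probability.LatticeModels
open Literature.MathematicalPhysics.QuantumFieldTheory (GaugeConfig wilsonMeasure LatticeRep isProbabilityMeasure_wilsonMeasure
  measurable_torusLift)
open Literature.MathematicalPhysics.QuantumLattice (LGConfig torusLift IsCylinder ymSpecification isProbabilityMeasure_ymSpecification
  integrable_of_abs_le fundamentalLatticeRep)

namespace Summit.QuantumFields.YangMills.Cruxes.UVSeamRec.DLRPeeling

open Summit.QuantumFields.YangMills.Cruxes.OSLegsFromFemtoAndGap.DlrCollarTransfer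
open Summit.QuantumFields.YangMills.Cruxes.UVSeamRec.PolymerData
open Summit.QuantumFields.YangMills.Cruxes.UVSeamRec.TemperedResponse
open Summit.QuantumFields.YangMills.Theorems.OddTorusChessboard (Orient)

/-! ## §1 The levels whose collar cube outgrows the torus: at most `m` of them -/

section Count

/-- **The non-fitting levels are at most `m`.**  On the (RM) torus (`4R+8 ≤ L`) the levels `k ≤ kmax` carrying shell polymers (`2b^k ≤ R`)
whose collar cube of side `(2m+1)b^k` does NOT fit (`2L+1 < (2m+1)b^k + 3`) satisfy `16·b^k ≤ 8R < (2m+1)·b^k`, so any two of them differ by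
less than `log_b((2m+1)/16) < m` (`b ≥ 3`, `2m+1 ≤ 3^m` — the tree's `Literature.Probability.LatticeModels.two_mul_add_one_le_three_pow`):
they form a set of at most `m` levels (empty for `m ≤ 7`). [folklore] -/
theorem card_badLevels_le (𝔟 : BlockSize) (m kmax R L : ℕ) (hRL : 4 * R + 8 ≤ L) :
    ((Finset.range (kmax + 1)).filter (fun k => 2 * 𝔟.b ^ k ≤ R ∧ 2 * L + 1 < (2 * m + 1) * 𝔟.b ^ k + 3)).card ≤ m := by
  classical
  set S := (Finset.range (kmax + 1)).filter (fun k => 2 * 𝔟.b ^ k ≤ R ∧ 2 * L + 1 < (2 * m + 1) * 𝔟.b ^ k + 3) with hS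
  rcases S.eq_empty_or_nonempty with h0 | hne
  · rw [h0, Finset.card_empty]; exact Nat.zero_le _
  obtain ⟨k₀, hk₀, hmin⟩ := S.exists_min_image id hne
  have hb3 : 3 ≤ 𝔟.b := BlockFieldLocality.three_le_b 𝔟
  have hsub : S ⊆ Finset.Ico k₀ (k₀ + m) := by
    intro k hk
    have hk' := (Finset.mem_filter.1 hk).2
    have hk₀' := (Finset.mem_filter.1 hk₀).2
    have hle : k₀ ≤ k := hmin k hk
    rw [Finset.mem_Ico]
    refine ⟨hle, ?_⟩
    obtain ⟨j, rfl⟩ := Nat.exists_eq_add_of_le hle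
    by_contra hcon
    have hjm : m ≤ j := by omega
    -- `16 b^{k₀} b^j ≤ 8R < (2m+1) b^{k₀}`, so `16 b^j < 2m+1`; but `b^j ≥ 3^m ≥ 2m+1`
    have hpow : 𝔟.b ^ (k₀ + j) = 𝔟.b ^ k₀ * 𝔟.b ^ j := pow_add _ _ _
    have hk0pos : 0 < 𝔟.b ^ k₀ := pow_pos 𝔟.pos _
    have h1 : 16 * (𝔟.b ^ k₀ * 𝔟.b ^ j) < (2 * m + 1) * 𝔟.b ^ k₀ := by
      rw [← hpow]; have := hk'.1; have := hk₀'.2; omega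
    have h2 : 16 * 𝔟.b ^ j < 2 * m + 1 := by
      rcases lt_or_ge (16 * 𝔟.b ^ j) (2 * m + 1) with h3 | h3
      · exact h3
      · have : (2 * m + 1) * 𝔟.b ^ k₀ ≤ 16 * 𝔟.b ^ j * 𝔟.b ^ k₀ := Nat.mul_le_mul_right _ h3
        have e : 16 * 𝔟.b ^ j * 𝔟.b ^ k₀ = 16 * (𝔟.b ^ k₀ * 𝔟.b ^ j) := by ring
        omega
    have h3 : 3 ^ m ≤ 𝔟.b ^ j := (Nat.pow_le_pow_left hb3 m).trans (Nat.pow_le_pow_right 𝔟.pos hjm)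
    have h4 : 2 * m + 1 ≤ 3 ^ m :=
      Literature.Probability.LatticeModels.two_mul_add_one_le_three_pow m
    omega
  calc S.card ≤ (Finset.Ico k₀ (k₀ + m)).card := Finset.card_le_card hsub
    _ = m := by rw [Nat.card_Ico]; omega

end Count

/-! ## §2 Doubled joint exponential moments of the influence functionals from (UCR), any collar `m ≥ 3` -/

section UCR

variable {N : ℕ} [NeZero N]

/-- **DOUBLED JOINT EXPONENTIAL MOMENTS OF THE INFLUENCE FUNCTIONALS FROM (UCR), ANY COLLAR.**  Fundamental Wilson state of `SU(N)` on the odd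
torus `2L+1`, `β ≥ 1`; a REDUCED cube family (`|x i c| ≤ L`), pairwise cyclically `2R+4`-separated, `1 ≤ R`, `4R+8 ≤ L`; ANY odd block size `𝔟`,
ANY collar `m ≥ 3`, thresholds `ε`, cutoff `kmax`; weights `w k ∈ [0,1]` with the ONE-BOX bound (UCR_k) at every level `k ≥ 1`:
`∀ y μ<ν η, kerE^η_{(b^k(y−m),(2m+1)b^k)}(1_{largeFieldEvent 𝔟 (ε k) (k,y,μ,ν)}) ≤ w k`.  THEN, with the constants `K₀, D₁` of the proved level-`0` law
and `K = 256(2m+4)⁴`:  `⟨exp(2 Σ_{i∈T} influence 𝔟 ε kmax R (x i)∘lift)⟩_{2L+1,β} ≤ exp(2e²·1536·(δ₀ + (Σ_{1≤k≤kmax} (w k)^{1/(16K)} + m))·#T)`.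
Proof: g3/g6's shell engine with level weights `θ_k = w_k^{1/(16K)}` at the levels whose collar cube fits in the torus (law from (UCR_k) by the
small-collar peeling supplier) and `θ_k = δ_k = 1` at the shell levels where it does not (trivial law); the latter are at most `m`
(`card_badLevels_le`).  No RP, no divisibility, every block size, every collar. [folklore] -/
theorem torusE_exp_two_mul_sum_influence_le_of_uniformConditionalRarity_anyCollar :
    ∃ K₀ : ℝ, ∃ D₁ : ℕ, ∀ (𝔟 : BlockSize) (m : ℕ), 3 ≤ m → ∀ (ε : ℕ → ℝ) (kmax R L : ℕ) (β : ℝ), 1 ≤ β →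
      ∀ {n : ℕ} (x : Fin n → (Fin 4 → ℤ)), 1 ≤ R → 4 * R + 8 ≤ L → (∀ i c, |x i c| ≤ (L : ℤ)) →
      (∀ i j : Fin n, i ≠ j → ∃ k : Fin 4,
        (2 * (R : ℤ) + 4) ≤ |((((x i k - x j k : ℤ) : ZMod (2 * L + 1))).valMinAbs : ℤ)|) →
      ∀ (w : ℕ → ℝ), (∀ k, 0 ≤ w k) → (∀ k, w k ≤ 1) →
      (∀ k : ℕ, 1 ≤ k → ∀ (y : Fin 4 → ℤ) (μ ν : Fin 4) (h : μ < ν) (η : LGConfig 4 (Matrix.specialUnitaryGroup (Fin N) ℂ)),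
        kerE (Matrix.specialUnitaryGroup (Fin N) ℂ) (fundamentalLatticeRep N) β (fun i => (𝔟.b : ℤ) ^ k * (y i - m)) ((2 * m + 1) * 𝔟.b ^ k) η
          ((largeFieldEvent (N := N) 𝔟 (ε k) ⟨k, y, μ, ν, h⟩).indicator fun _ => (1 : ℝ)) ≤ w k) →
      ∀ T : Finset (Fin n),
        torusE (Matrix.specialUnitaryGroup (Fin N) ℂ) (fundamentalLatticeRep N) β L
            (fun U => Real.exp (((2 : ℕ) : ℝ) * ∑ i ∈ T, influence (N := N) 𝔟 ε kmax R (x i) U)) ≤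
          Real.exp (2 * Real.exp (2 * 1) * (1536 * (Real.exp (-(β * ((N : ℝ) * ε 0)) / Fintype.card (Orient 4) +
            (K₀ + D₁ * Real.log β) / Fintype.card (Orient 4)) +
            (∑ k ∈ (Finset.range (kmax + 1)).filter (fun k => 1 ≤ k), w k ^ ((1 : ℝ) / (16 * (256 * (2 * m + 4) ^ 4))) + m))) *
            T.card) := by
  classical
  obtain ⟨K₀, D₁, hShell⟩ := torusE_exp_two_mul_sum_influence_le_of_shellWindowCellLaws (N := N)
  refine ⟨K₀, D₁, ?_⟩
  intro 𝔟 m hm ε kmax R L β hβ n x hR hRL hred hsep w hw0 hw1 hUCR T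
  haveI := isProbabilityMeasure_wilsonMeasure (d := 4) (L := 2 * L + 1) (fundamentalLatticeRep N).ρ
    (fundamentalLatticeRep N).continuous β
  set K : ℝ := 256 * (2 * (m : ℝ) + 4) ^ 4 with hKdef
  have hK0 : 0 < K := by rw [hKdef]; positivity
  -- the levels whose collar cube does not fit in the torus although they carry shell polymers
  let bad : ℕ → Prop := fun k => 2 * 𝔟.b ^ k ≤ R ∧ 2 * L + 1 < (2 * m + 1) * 𝔟.b ^ k + 3
  -- weights `θ k = (w k)^{1/(16K)}` / activities `δ k = (w k)^{1/K}` at the good levels, `1` at the bad ones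
  set θ : ℕ → ℝ := fun k => if bad k then 1 else w k ^ ((1 : ℝ) / (16 * K)) with hθdef
  set δ : ℕ → ℝ := fun k => if bad k then 1 else w k ^ ((1 : ℝ) / K) with hδdef
  have hθ0 : ∀ k, 0 ≤ θ k := fun k => by
    simp only [hθdef]; split_ifs
    · exact zero_le_one
    · exact Real.rpow_nonneg (hw0 k) _
  have hθ1 : ∀ k, θ k ≤ 1 := fun k => by
    simp only [hθdef]; split_ifs
    · exact le_rfl
    · exact Real.rpow_le_one (hw0 k) (hw1 k) (by positivity)
  have hδ0 : ∀ k, 0 ≤ δ k := fun k => by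
    simp only [hδdef]; split_ifs
    · exact zero_le_one
    · exact Real.rpow_nonneg (hw0 k) _
  have hδθ : ∀ k, δ k ≤ θ k ^ 16 := fun k => by
    simp only [hθdef, hδdef]
    split_ifs
    · rw [one_pow]
    · rw [← Real.rpow_natCast (w k ^ ((1 : ℝ) / (16 * K))) 16, ← Real.rpow_mul (hw0 k),
        show (1 : ℝ) / (16 * K) * ((16 : ℕ) : ℝ) = 1 / K by field_simp; ring]
  -- the budget: `Σ θ ≤ Σ w^{1/(16K)} + #bad ≤ Σ w^{1/(16K)} + m`
  have hbudget : ∑ k ∈ (Finset.range (kmax + 1)).filter (fun k => 1 ≤ k), θ k ≤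
      ∑ k ∈ (Finset.range (kmax + 1)).filter (fun k => 1 ≤ k), w k ^ ((1 : ℝ) / (16 * K)) + m := by
    have hpt : ∀ k, θ k ≤ w k ^ ((1 : ℝ) / (16 * K)) + (if bad k then (1 : ℝ) else 0) := fun k => by
      simp only [hθdef]
      split_ifs
      · have := Real.rpow_nonneg (hw0 k) ((1 : ℝ) / (16 * K)); linarith
      · rw [add_zero]
    refine (Finset.sum_le_sum fun k _ => hpt k).trans ?_
    rw [Finset.sum_add_distrib, Finset.sum_boole]
    refine add_le_add le_rfl ?_
    have hcard := card_badLevels_le 𝔟 m kmax R L hRL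
    have hsub : ((Finset.range (kmax + 1)).filter (fun k => 1 ≤ k)).filter (fun k => bad k) ⊆
        (Finset.range (kmax + 1)).filter (fun k => 2 * 𝔟.b ^ k ≤ R ∧ 2 * L + 1 < (2 * m + 1) * 𝔟.b ^ k + 3) := by
      intro k hk
      simp only [Finset.mem_filter] at hk ⊢
      exact ⟨hk.1.1, hk.2⟩
    exact_mod_cast (Finset.card_le_card hsub).trans hcard
  have h := hShell 𝔟 ε kmax R L β hβ x hR hRL hred hsep θ δ hθ0 hθ1 hδ0 hδθ ?_ T
  · refine h.trans (Real.exp_le_exp.2 (mul_le_mul_of_nonneg_right ?_ (Nat.cast_nonneg _)))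
    refine mul_le_mul_of_nonneg_left (mul_le_mul_of_nonneg_left (add_le_add le_rfl ?_) (by norm_num)) (by positivity)
    simpa only [hKdef] using hbudget
  -- the shell laws: (UCR) at the fitting levels, trivial at the others
  intro k hk o A hA hwin
  have hAk : ∀ γ ∈ A, γ.k = k := fun γ hγ => (Finset.mem_filter.1 (hA hγ)).2
  rcases A.eq_empty_or_nonempty with hAe | ⟨γ₀, hγ₀⟩
  · subst hAe
    simp only [Finset.prod_empty]
    unfold torusE
    rw [integral_const, smul_eq_mul, mul_one, probReal_univ]
  -- a shell polymer of level `k`: `2b^k ≤ R`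
  have h2bk : 2 * 𝔟.b ^ k ≤ R := by
    obtain ⟨i, _, hi⟩ := Finset.mem_biUnion.1 (Finset.mem_filter.1 (hA hγ₀)).1
    have hshell := (mem_shell_iff 𝔟 kmax R (x i) γ₀).1 hi
    have h2 : 2 * 𝔟.b ^ γ₀.k ≤ R := by have := hshell.2.1.trans hshell.2.2; omega
    rwa [hAk γ₀ hγ₀] at h2
  by_cases hfit : (2 * m + 1) * 𝔟.b ^ k + 3 ≤ 2 * L + 1
  · have hnb : ¬ bad k := fun hb => absurd hfit (not_le.2 hb.2)
    have hlaw := torusE_prod_indicator_largeField_le_of_uniformKernelBound_smallCollar (N := N) (fundamentalLatticeRep N) β 𝔟 m hm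
      (ε k) k L hfit (w k) (hw0 k) (hw1 k) (hUCR k hk) o A hAk hwin
    simpa only [hδdef, hnb, if_false, hKdef] using hlaw
  · have hb : bad k := ⟨h2bk, not_le.1 hfit⟩
    simp only [hδdef, hb, if_true, Finset.prod_const_one]
    have h1 := torusE_prod_indicator_anti (fundamentalLatticeRep N) β L (fun γ => largeFieldEvent (N := N) 𝔟 (ε k) γ)
      (fun γ => measurableSet_largeFieldEvent (N := N) 𝔟 _ γ) (Finset.empty_subset A)
    refine h1.trans (le_of_eq ?_)
    simp only [Finset.prod_empty]
    unfold torusE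
    rw [integral_const, smul_eq_mul, mul_one, probReal_univ]

end UCR

end Summit.QuantumFields.YangMills.Cruxes.UVSeamRec.DLRPeeling

end
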